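import Mathlib
import HarnessLib
import Literature.Analysis.FluidPDE.ClassicalSolution
import Literature.Analysis.FluidPDE.LerayHopf
import Literature.Analysis.FluidPDE.SelfSimilar
import Literature.Analysis.FluidPDE.SelfSimilarLiouville
import Literature.Analysis.FluidPDE.LocalTypeI
import Literature.Analysis.FluidPDE.VectorCalculus
import Literature.Analysis.FluidPDE.TypeIAncientMild
import Literature.Analysis.FluidPDE.ChaeWolfRemovingDSS
import Literature.Analysis.FluidPDE.ChaeWolfRemovingDSSProofs
import Literature.Analysis.FluidPDE.ChaeWolfRemovingDSSLimit
import Literature.Analysis.UnboundedOperators.HeatKernel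
import Summits.NavierStokesRegularity.NavierStokesRegularity.Theorems.LocalVelCompTubeDoorLocalPointZoomVelSlices
import Summits.NavierStokesRegularity.NavierStokesRegularity.Theorems.PlaneStrainDoorZoomSpaceTimeDecay
import Summits.NavierStokesRegularity.NavierStokesRegularity.Theorems.LocalSineTubeDoorProfileAlignedWindowRigidityAncient
import Summits.NavierStokesRegularity.NavierStokesRegularity.Theorems.PoloidalWindowDoorPoloidalWindowRigidityStrata
import Summits.NavierStokesRegularity.NavierStokesRegularity.Theorems.PoloidalWindowDoorPoloidalWindowRigidityFlat
import Summits.NavierStokesRegularity.NavierStokesRegularity.Theorems.PoloidalWindowDoorPoloidalWindowRigidityWindow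
import Summits.NavierStokesRegularity.NavierStokesRegularity.Theorems.TypeIDSSLiouvilleConjecture
import Summits.NavierStokesRegularity.NavierStokesRegularity.Theorems.AdaptedFrequencyTangentFlowTransferAncientPressure
import Summits.NavierStokesRegularity.NavierStokesRegularity.Theorems.PeepholeEchoDoorDefs
import Summits.NavierStokesRegularity.NavierStokesRegularity.Theorems.ZoomReturnDoorWindowLimit
import Summits.NavierStokesRegularity.NavierStokesRegularity.Theorems.ZoomReturnDoorRemovableFactors

/-!
# ZoomReturnDoorDoors — S25 «ZoomReturnDoor» (small echoes near ratio one; removable DSS factors), part 4/4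

§3 the DOORS: `closesA` (logic), `targetSmallEchoAt_of_residue`; FROM K-band: `smallEchoResidueAt_of_bandStability`
(R-small), `targetSmallEcho_of_bandStability` (door T5⁺, all constants), `targetBand_of_bandStability` (general band door,
conditional on the removability of the band at decay `M/ν`), `targetRestlessAt_of_smallEcho` (T5⁺ ⇒ T6) and
`targetRestless_of_bandStability` (door T6 «restless profile»).

Door family of LADDER-NS N0 (local Type-I window doors S20–S25); THEOREMS-ONLY landing of the nsreg-p1 design
`run/shared/lean/pub/ns-regularity-ideate/ns-regularity-ideate-p1/r24/Sketch25.lean` (ROUND-24.md).  Door T5⁺ «no SMALL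
near-one echo»: a space–time local Type-I point whose two-time defect at a ratio in a near-one band is EVENTUALLY `ε`-small on
a window (`ε` fixed before the ratio) is regular; corollary door T6 «restless profile».  Everything conditional is conditional on
the two CLAIMED compactness theorems K-band `BandStability` / K-open `RemovableSetOpen` (Chae–Wolf 2017 §3 engine, tree
`Literature.Analysis.FluidPDE.ChaeWolf.exists_limit`, run with a convergent factor sequence), which enter as hypotheses.
No route, no items (DIRECTOR-NS standing #32 (2)).  WHAT THIS IS NOT: not a regularity claim; not an attack on
`TypeIDSSLiouville`; the band door is EXACTLY as strong as the graded DSS wall on its band (`removable_of_bandResidue`).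
-/

noncomputable section

set_option linter.dupNamespace false

namespace Summit.NavierStokesRegularity.NavierStokesRegularity.Theorems.ZoomReturnDoorDoors

open MeasureTheory Set Function Filter Topology TopologicalSpace Metric
open scoped RealInnerProductSpace NNReal ENNReal Topology Pointwise
open Literature.Analysis Literature.Analysis.FluidPDE
open Summit.NavierStokesRegularity.NavierStokesRegularity.Theorems.LocalSineTubeDoorProfileAlignedWindowRigidityAncient
open Summit.NavierStokesRegularity.NavierStokesRegularity.Theorems.PoloidalWindowDoorPoloidalWindowRigidityStrata
open Summit.NavierStokesRegularity.NavierStokesRegularity.Theorems.PoloidalWindowDoorPoloidalWindowRigidityFlat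
open Summit.NavierStokesRegularity.NavierStokesRegularity.Theorems.PoloidalWindowDoorPoloidalWindowRigidityWindow
open Summit.NavierStokesRegularity.NavierStokesRegularity.Theorems.PeepholeEchoDoorDefs
open Summit.NavierStokesRegularity.NavierStokesRegularity.Theorems.ZoomReturnDoorDefs
open Summit.NavierStokesRegularity.NavierStokesRegularity.Theorems.ZoomReturnDoorWindowLimit
open Summit.NavierStokesRegularity.NavierStokesRegularity.Theorems.ZoomReturnDoorRemovableFactors

/-- `closesA`: door T5⁺ at constants `ν, M` from K1-small and the small-echo residue at decay `M/ν` (logic). -/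
theorem closesA (ν M : ℝ) (hν : 0 < ν) (h₁ : LocalPointZoomSmallEcho) (h₂ : SmallEchoResidueAt ν (M / ν)) :
    TargetSmallEchoAt ν M := by
  obtain ⟨κ₁, hκ₁0, hκ₁1, hres⟩ := h₂
  refine ⟨κ₁, hκ₁0, hκ₁1, fun a b ha hb U hU hUne hUbdd => ?_⟩
  obtain ⟨ε, hε, hεres⟩ := hres a b ha hb U hU hUne hUbdd
  refine ⟨ε, hε, fun κ hκ T hT u p hcl hLH hdec x₀ ρ hρ hM hsmall => ?_⟩
  by_contra hnot
  have hκ0 : 0 < κ := hκ₁0.trans (ha.trans_le hκ.1)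
  obtain ⟨C, v, hcls, hdecay, hsing, hecho⟩ := h₁ ν T hν hT u p hcl hLH hdec x₀ ρ M hρ hM hnot
  exact hεres κ hκ C v hcls hdecay (hecho κ (Real.sqrt κ) ε hκ0 U hsmall) hsing

/-- Part A assembly holds (logic). -/
theorem assemblyA_holds (ν M : ℝ) (hν : 0 < ν) : AssemblyA ν M := fun h₁ h₂ => closesA ν M hν h₁ h₂

/-- Door T5⁺ is PROVED modulo the small-echo residue alone. -/
theorem targetSmallEchoAt_of_residue (ν M : ℝ) (hν : 0 < ν) (h₂ : SmallEchoResidueAt ν (M / ν)) :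
    TargetSmallEchoAt ν M :=
  closesA ν M hν localPointZoomSmallEcho_holds h₂

/-- **R-small FROM K-band (PROVED):** the small-echo residue of Part A at every viscosity and decay constant.  The
door-class profile is upgraded to a classical solution on `(−∞,0)` by the tree (`isTypeIAncientMild_of_class`,
`exists_isClassicalNSSolutionOn_Iio_of_isTypeIAncientMild`); a non-positive decay constant is degenerate. -/
theorem smallEchoResidueAt_of_bandStability (hB : BandStability) {ν : ℝ} (D : ℝ) (hν : 0 < ν) :
    SmallEchoResidueAt ν D := by
  rcases le_or_gt D 0 with hD | hD
  · refine ⟨1 / 2, by norm_num, by norm_num, fun a b _ _ U _ _ _ => ⟨1, one_pos, fun κ _ C v _ hdec _ => ?_⟩⟩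
    apply not_isBackwardSingularPoint_of_eq_zero
    intro s hs z
    have hsq : 0 < Real.sqrt (-s) := Real.sqrt_pos.2 (by linarith)
    have hden : 0 < ‖z‖ + Real.sqrt (-s) := by positivity
    have hle : ‖v s z‖ ≤ 0 := (hdec s hs z).trans (div_nonpos_iff.2 (Or.inr ⟨hD, hden.le⟩))
    exact norm_le_zero_iff.1 hle
  · obtain ⟨κ₁, hκ₁0, hκ₁1, hband⟩ := bandResidue_nearOne hB hν hD
    refine ⟨κ₁, hκ₁0, hκ₁1, fun a b ha hb U hU hne hbdd => ?_⟩
    obtain ⟨ε, hε, hres⟩ := hband a b ha hb U hU hne hbdd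
    refine ⟨ε, hε, fun κ hκ C v hcls hdec hecho => ?_⟩
    obtain ⟨hrate, hcont, hmild, hdiv⟩ := hcls
    have hmildcls : IsTypeIAncientMild C v := isTypeIAncientMild_of_class hrate hcont hmild hdiv
    obtain ⟨q, hcl⟩ :=
      Summit.NavierStokesRegularity.NavierStokesRegularity.Theorems.exists_isClassicalNSSolutionOn_Iio_of_isTypeIAncientMild
        hmildcls
    exact not_isBackwardSingularPoint_of_eq_zero (hres κ hκ v q hcl hdec hecho)

/-- **Door T5⁺ FROM K-band ALONE (PROVED):** K1-small is a theorem, R-small follows from K-band. -/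
theorem targetSmallEcho_of_bandStability (hB : BandStability) : TargetSmallEcho :=
  fun ν M hν => targetSmallEchoAt_of_residue ν M hν (smallEchoResidueAt_of_bandStability hB (M / ν) hν)

/-- **THE CONDITIONAL BAND DOOR (PROVED from K1-small + K-band):** a band of ratios whose factors are removable at decay
`M/ν` carries door T5-band at constants `ν, M`.  Near one this is T5⁺ unconditionally-modulo-K-band (Chae–Wolf);
in general it is conditional on exactly the graded DSS wall on the band, and by `removable_of_bandResidue` on
nothing less. -/
theorem targetBand_of_bandStability (hB : BandStability) {ν M a b : ℝ} (hν : 0 < ν) (ha : 0 < a) (hb : b < 1)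
    (hrem : ∀ κ ∈ Set.Icc a b, RemovableFactor (M / ν) (Real.sqrt κ)⁻¹) : TargetSmallEchoBandAt ν M a b := by
  intro U hU hne hbdd
  rcases le_or_gt (M / ν) 0 with hD | hD
  · refine ⟨1, one_pos, fun κ _ T hT u p hcl hLH hdec x₀ ρ hρ hM _ => ?_⟩
    by_contra hnot
    obtain ⟨C, v, _, hdecay, hsing, _⟩ :=
      localPointZoomSmallEcho_holds ν T hν hT u p hcl hLH hdec x₀ ρ M hρ hM hnot
    refine not_isBackwardSingularPoint_of_eq_zero (fun s hs z => ?_) hsing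
    have hsq : 0 < Real.sqrt (-s) := Real.sqrt_pos.2 (by linarith)
    have hden : 0 < ‖z‖ + Real.sqrt (-s) := by positivity
    have hle : ‖v s z‖ ≤ 0 := (hdecay s hs z).trans (div_nonpos_iff.2 (Or.inr ⟨hD, hden.le⟩))
    exact norm_le_zero_iff.1 hle
  · obtain ⟨ε, hε, hres⟩ := hB ν (M / ν) a b hν hD ha hb hrem U hU hne hbdd
    refine ⟨ε, hε, fun κ hκ T hT u p hcl hLH hdec x₀ ρ hρ hM hsmall => ?_⟩
    by_contra hnot
    have hκ0 : 0 < κ := ha.trans_le hκ.1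
    obtain ⟨C, v, hcls, hdecay, hsing, hecho⟩ :=
      localPointZoomSmallEcho_holds ν T hν hT u p hcl hLH hdec x₀ ρ M hρ hM hnot
    obtain ⟨hrate, hcont, hmild, hdiv⟩ := hcls
    have hmildcls : IsTypeIAncientMild C v := isTypeIAncientMild_of_class hrate hcont hmild hdiv
    obtain ⟨q, hclv⟩ :=
      Summit.NavierStokesRegularity.NavierStokesRegularity.Theorems.exists_isClassicalNSSolutionOn_Iio_of_isTypeIAncientMild
        hmildcls
    exact not_isBackwardSingularPoint_of_eq_zero
      (hres κ hκ v q hclv hdecay (hecho κ (Real.sqrt κ) ε hκ0 U hsmall)) hsing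

/-- **T5⁺ ⇒ T6** (PROVED, bookkeeping: one near-one band `[a,b] ⊂ (κ₁,1) ∩ [e^{−h₀},1)` and `ε := ε₅/h₀`). -/
theorem targetRestlessAt_of_smallEcho {ν M : ℝ} (h : TargetSmallEchoAt ν M) : TargetRestlessAt ν M := by
  intro U hU hUne hUb h₀ hh₀
  obtain ⟨κ₁, hκ₁0, hκ₁1, hband⟩ := h
  set a : ℝ := max ((κ₁ + 1) / 2) (Real.exp (-h₀)) with ha_def
  have hexp1 : Real.exp (-h₀) < 1 := Real.exp_lt_one_iff.2 (by linarith)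
  have ha1 : a < 1 := max_lt (by linarith) hexp1
  have hκa : κ₁ < a := lt_of_lt_of_le (by linarith) (le_max_left _ _)
  have ha0 : 0 < a := lt_of_lt_of_le (Real.exp_pos _) (le_max_right _ _)
  set b : ℝ := (a + 1) / 2 with hb_def
  have hab : a < b := by rw [hb_def]; linarith
  have hb1 : b < 1 := by rw [hb_def]; linarith
  have hb0 : 0 < b := ha0.trans hab
  obtain ⟨ε₅, hε₅, hdoor⟩ := hband a b hκa hb1 U hU hUne hUb
  refine ⟨ε₅ / h₀, div_pos hε₅ hh₀, ?_⟩
  intro T hT u p hcl hLH hdec x₀ ρ hρ hM hsmall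
  have hbmem : b ∈ Set.Icc a b := ⟨hab.le, le_rfl⟩
  refine hdoor b hbmem T hT u p hcl hLH hdec x₀ ρ hρ hM ?_
  have hb_lo : Real.exp (-h₀) ≤ b := le_trans (le_max_right _ _) hab.le
  have hlog : Real.log b⁻¹ ≤ h₀ := by
    rw [Real.log_inv]
    have h1 : Real.log (Real.exp (-h₀)) ≤ Real.log b := Real.log_le_log (Real.exp_pos _) hb_lo
    rw [Real.log_exp] at h1
    linarith
  have hle : ε₅ / h₀ * Real.log b⁻¹ ≤ ε₅ := by
    calc ε₅ / h₀ * Real.log b⁻¹ ≤ ε₅ / h₀ * h₀ := by gcongr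
      _ = ε₅ := by field_simp
  unfold DefectEventuallySmall
  filter_upwards [hsmall] with t ht
  exact (ht b hb_lo hb1).trans (ENNReal.ofReal_le_ofReal hle)

/-- **K-band ⇒ door T6 for all constants.** -/
theorem targetRestless_of_bandStability (hB : BandStability) : TargetRestless :=
  fun ν M hν => targetRestlessAt_of_smallEcho (targetSmallEcho_of_bandStability hB ν M hν)

end Summit.NavierStokesRegularity.NavierStokesRegularity.Theorems.ZoomReturnDoorDoors
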